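import Mathlib
import HarnessLib
import Summits.QuantumFields.YangMills.Theses.GuardedThresholdRemoval

/-!
# GuardedThresholdRemoval — glue of the split of `GuardedTransfer` (LINE g7-C of ideator seat ym-idea-1)

Route `route-QuantumFields-GuardedThresholdRemoval` (closes rung R3 `T3YM3TorusStatement.YM3TorusSU2` BY NAME; no summit is proved by this
line) splits its transfer crux `GuardedTransfer` (stmt-QuantumFields-28026) into `ThinLevyCauchy` (thin-set Lévy–Cauchy transfer: for a
family whose unit laws are thin at the guard spheres and whose scheme strings converge, the integral of every bounded measurable
gauge-invariant observable continuous OFF the guard spheres converges) and `CoarseObsContinuousOffGuard` (the one-step coarse observable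
`coarseObs F 1 ℰp Cs` is continuous off the guard spheres).  This file proves the glue `ThinLevyCauchy → CoarseObsContinuousOffGuard →
GuardedTransfer`: the refinement identity `T3ThresholdRemoval.expectAt_refine` (step `K+1` strings of `F` = integrals of `coarseObs`
against the refined family's step-`K` unit law), `tendsto_add_atTop_iff_nat`, and — on `SU(2)` for a measurable averaging — uniqueness /
reflection positivity / covariance of the limit points OUTRIGHT (`continuumYM3Torus_iff_hasContinuumLimit_SU`), so that only EXISTENCE is
transferred; the ℰp twin of tree `T3ThresholdRemoval.hasContinuumLimit_of_refine` with the continuity of `coarseObs` replaced by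
continuity off a thin set.
-/

open MeasureTheory Filter Topology
open Literature.MathematicalPhysics.QuantumFieldTheory.Balaban1983to89
open Literature.MathematicalPhysics.QuantumFieldTheory.Balaban1983to89.Missing
open Literature.MathematicalPhysics.QuantumFieldTheory.Balaban1983to89.T3ContinuumYM3Torus
open Literature.MathematicalPhysics.QuantumFieldTheory.Balaban1983to89.T3LevelShift
open Literature.MathematicalPhysics.QuantumFieldTheory.Balaban1983to89.T3ThresholdRemoval
open Literature.MathematicalPhysics.QuantumFieldTheory.Balaban1983to89.T3UnitLawDensityEML (ℰp measurableE_ℰp)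

namespace Summit.QuantumFields.YangMills.Theses.GuardedThresholdRemoval

/-- **`ThinLevyCauchy → CoarseObsContinuousOffGuard → GuardedTransfer`**: existence of the continuum limit of the refined pair
`(F.refine 1, γ/L)` at the printed averaging transfers to `(F, γ)` once the refined unit laws are thin at the guard spheres. [cite: JaffeWittenClay2006, §6.5 p.11] -/
theorem guardedTransfer_of_thinLevy (h₁ : ThinLevyCauchy) (h₂ : CoarseObsContinuousOffGuard) : GuardedTransfer := by
  intro F γ hγ hthin hC
  have hL0 : (0 : ℝ) ≤ ((F.L : ℝ))⁻¹ := inv_nonneg.mpr (Nat.cast_nonneg _)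
  have hγ' : 0 ≤ γ * ((F.L : ℝ)⁻¹) ^ 1 := mul_nonneg hγ.le (pow_nonneg hL0 _)
  have hHC : HasContinuumLimit ((F.refine 1).scheme ℰp (γ * ((F.L : ℝ)⁻¹) ^ 1)) :=
    (continuumYM3Torus_iff_hasContinuumLimit_SU (F.refine 1) ℰp measurableE_ℰp hγ').mp hC
  refine (continuumYM3Torus_iff_hasContinuumLimit_SU F ℰp measurableE_ℰp hγ.le).mpr ?_
  intro Cs
  obtain ⟨l, hl⟩ := h₁ (F.refine 1) _ hγ' hthin hHC (coarseObs F 1 ℰp Cs)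
    (measurable_coarseObs F 1 ℰp measurableE_ℰp Cs) (abs_coarseObs_le_one F 1 ℰp Cs) (coarseObs_gaugeAct F 1 ℰp Cs) (h₂ F Cs)
  refine ⟨l, (tendsto_add_atTop_iff_nat 1).mp ?_⟩
  have hkey : (fun K => (F.scheme ℰp γ).expectAt (K + 1) Cs) =
      fun K => ∫ u, coarseObs F 1 ℰp Cs u ∂(F.refine 1).unitLaw ℰp measurableE_ℰp (γ * ((F.L : ℝ)⁻¹) ^ 1) K :=
    funext fun K => expectAt_refine F 1 ℰp measurableE_ℰp hγ.le K Cs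
  rw [hkey]
  exact hl

/-- The glue item `GuardedTransferGlue` of the split, by name. [cite: JaffeWittenClay2006, §6.5 p.11] -/
theorem guardedTransferGlue_holds : GuardedTransferGlue := fun h₁ h₂ => guardedTransfer_of_thinLevy h₁ h₂

end Summit.QuantumFields.YangMills.Theses.GuardedThresholdRemoval
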